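import Mathlib

/-! # Stub `stub_normIteratedFDerivLe` of line `Sketch` for crux `TameOrBrodyR4` (stmt-SmoothPoincare4-7826, route SullivanDual)

An elementary bridge between the operator norm of an `ℝ`-multilinear map on `ℂⁿ` and its values
on basis tuples: for a continuous `ℝ`-multilinear `T : ℂⁿ → F` (in the stub, `F = ℝ⁴`),

  `‖T‖ ≤ ∑_{L : Fin n → Fin 2} ‖T (e_{L 0}, …, e_{L (n-1)})‖`, with `e₀ = 1`, `e₁ = i`.

Proof: expand every argument along the real basis `(1, i)` of `ℂ`,
`v j = (re v j) • 1 + (im v j) • i`, use multilinearity (`ContinuousMultilinearMap.map_sum`,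
`ContinuousMultilinearMap.map_smul_univ`) to get
`T v = ∑_L (∏ j, c_{L j} (v j)) • T (e ∘ L)` with `c₀ = re`, `c₁ = im`, bound
`|re w|, |im w| ≤ ‖w‖`, and conclude with `ContinuousMultilinearMap.opNorm_le_bound`.
The lead uses it with `T = iteratedFDeriv ℝ n g z` to pass from directional ("word") derivatives
of a map `g : ℂ → ℝ⁴` to the norm of its `n`-th Fréchet derivative.
-/

noncomputable section

open scoped ContDiff Topology
open Filter Set

-- the registered namespace `Summit.SmoothPoincare4.SmoothPoincare4.…` repeats a component
set_option linter.dupNamespace false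

namespace Summit.SmoothPoincare4.SmoothPoincare4.Cruxes.TameOrBrodyR4.Sketch

/-- Local notation for the model space `ℝ⁴ = EuclideanSpace ℝ (Fin 4)`. -/
local notation "E4" => EuclideanSpace ℝ (Fin 4)

namespace NormIteratedFDerivLe

variable {F : Type*} [NormedAddCommGroup F] [NormedSpace ℝ F]

/-- Every complex number is `re v • 1 + im v • i`, written as a sum over `Fin 2` against the
real basis `![1, i]` with coefficients `![re v, im v]`. -/
theorem sum_reIm_smul (v : ℂ) :
    ∑ i : Fin 2, (![v.re, v.im] i) • ![(1 : ℂ), Complex.I] i = v := by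
  rw [Fin.sum_univ_two]
  show v.re • (1 : ℂ) + v.im • Complex.I = v
  rw [Complex.real_smul, Complex.real_smul, mul_one, Complex.re_add_im]

/-- The real coordinates `re v`, `im v` of a complex number are bounded by its norm. -/
theorem abs_reIm_le (v : ℂ) (i : Fin 2) : |![v.re, v.im] i| ≤ ‖v‖ := by
  fin_cases i
  exacts [Complex.abs_re_le_norm v, Complex.abs_im_le_norm v]

/-- Expansion of a continuous `ℝ`-multilinear map on `ℂⁿ` along the real basis `(1, i)` in every
slot: `T v = ∑_L (∏ j, c_{L j} (v j)) • T (e ∘ L)`. -/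
theorem apply_eq_sum {n : ℕ} (T : ContinuousMultilinearMap ℝ (fun _ : Fin n => ℂ) F)
    (v : Fin n → ℂ) :
    T v = ∑ L : Fin n → Fin 2,
      (∏ j, ![(v j).re, (v j).im] (L j)) • T (fun j => ![(1 : ℂ), Complex.I] (L j)) := by
  have hv : v = fun j => ∑ i : Fin 2, (![(v j).re, (v j).im] i) • ![(1 : ℂ), Complex.I] i :=
    funext fun j => (sum_reIm_smul (v j)).symm
  have hT : T v = T (fun j => ∑ i : Fin 2, (![(v j).re, (v j).im] i) • ![(1 : ℂ), Complex.I] i) :=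
    congrArg T hv
  rw [hT, ContinuousMultilinearMap.map_sum T
    (fun j (i : Fin 2) => (![(v j).re, (v j).im] i) • ![(1 : ℂ), Complex.I] i)]
  exact Finset.sum_congr rfl fun L _ =>
    T.map_smul_univ (fun j => ![(v j).re, (v j).im] (L j)) (fun j => ![(1 : ℂ), Complex.I] (L j))

/-- Pointwise bound: `‖T v‖ ≤ (∑_L ‖T (e ∘ L)‖) * ∏ j, ‖v j‖`. -/
theorem norm_apply_le {n : ℕ} (T : ContinuousMultilinearMap ℝ (fun _ : Fin n => ℂ) F)
    (v : Fin n → ℂ) :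
    ‖T v‖ ≤ (∑ L : Fin n → Fin 2, ‖T (fun j => ![(1 : ℂ), Complex.I] (L j))‖) * ∏ j, ‖v j‖ := by
  rw [apply_eq_sum T v, Finset.sum_mul]
  refine (norm_sum_le _ _).trans (Finset.sum_le_sum fun L _ => ?_)
  rw [norm_smul, Real.norm_eq_abs, Finset.abs_prod]
  exact (mul_le_mul_of_nonneg_right
    (Finset.prod_le_prod (fun j _ => abs_nonneg _) fun j _ => abs_reIm_le (v j) (L j))
    (norm_nonneg _)).trans_eq (mul_comm _ _)

/-- Operator-norm bound for a continuous `ℝ`-multilinear map on `ℂⁿ` with values in any real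
normed space: `‖T‖ ≤ ∑_{L : Fin n → Fin 2} ‖T (e ∘ L)‖`, `e = ![1, i]`. -/
theorem opNorm_le_sum {n : ℕ} (T : ContinuousMultilinearMap ℝ (fun _ : Fin n => ℂ) F) :
    ‖T‖ ≤ ∑ L : Fin n → Fin 2, ‖T (fun j => ![(1 : ℂ), Complex.I] (L j))‖ :=
  ContinuousMultilinearMap.opNorm_le_bound (Finset.sum_nonneg fun _ _ => norm_nonneg _)
    (norm_apply_le T)

end NormIteratedFDerivLe

/-- **Stub (worker; a multilinear map on `ℂⁿ` is controlled by its values on basis tuples).**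
For a continuous `ℝ`-multilinear `T : ℂⁿ → ℝ⁴`, `‖T‖ ≤ ∑_{L : Fin n → Fin 2} ‖T(e_{L 0}, …)‖`
with `e₀ = 1`, `e₁ = i`. Proof: expand each argument `v j = (re v j) • 1 + (im v j) • i`
(`ContinuousMultilinearMap.map_sum`, `map_smul_univ`), bound `|re v j|, |im v j| ≤ ‖v j‖`, and
conclude with `ContinuousMultilinearMap.opNorm_le_bound`
(see `NormIteratedFDerivLe.opNorm_le_sum` for a general real normed target). -/
theorem stub_normIteratedFDerivLe (n : ℕ) (T : ContinuousMultilinearMap ℝ (fun _ : Fin n => ℂ) E4) :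
    ‖T‖ ≤ ∑ L : Fin n → Fin 2, ‖T (fun j => ![(1 : ℂ), Complex.I] (L j))‖ := by
  exact NormIteratedFDerivLe.opNorm_le_sum T

end Summit.SmoothPoincare4.SmoothPoincare4.Cruxes.TameOrBrodyR4.Sketch
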